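import Summits.MatrixMultiplication.MatrixMultiplication.Theses.FourierTwoFamiliesModP

/-!
# Route `FourierTwoFamiliesModP` — the assembly item

Item `stmt-MatrixMultiplication-14318` (`Assembly`) of route
`route-MatrixMultiplication-FourierTwoFamiliesModP` is the implication
`PrimeTwoFamilies → MatrixMultiplication`, which is literally the type of the route's
deciding theorem `closes` (gate-certified, sorry-free, proved in the route file from the tree
theorems `addSimultaneousTPP_of_sdpp`, `exists_cornerFree_indexMaps_card_ge`,
`CohnKleinbergSzegedyUmans2005_5_5_abelian_holds`, `omega_two_le`, `omega_le_three'`).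
This file closes the item by applying `closes`.
-/

-- single-conjunct summit: the mandated namespace `Summit.MatrixMultiplication.MatrixMultiplication.…`
-- repeats `MatrixMultiplication` (summit = sub-problem), which `linter.dupNamespace` would flag.
set_option linter.dupNamespace false

namespace Summit.MatrixMultiplication.MatrixMultiplication.Theorems

open Summit.MatrixMultiplication.MatrixMultiplication.Theses.FourierTwoFamiliesModP

/-- The assembly item of route `FourierTwoFamiliesModP`: the prime-cyclic two-families target
`PrimeTwoFamilies` implies `MatrixMultiplication` (i.e. `ω(ℂ) = 2`). This is exactly the route's
deciding theorem `closes`. -/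
theorem fourierTwoFamiliesModP_assembly_proof :
    Summit.MatrixMultiplication.MatrixMultiplication.Theses.FourierTwoFamiliesModP.Assembly := by
  unfold Summit.MatrixMultiplication.MatrixMultiplication.Theses.FourierTwoFamiliesModP.Assembly
  exact fun hT => closes hT

end Summit.MatrixMultiplication.MatrixMultiplication.Theorems
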